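import Summits.CriticalPhenomena.PercolationContinuityZ3.Theorems.PercNearOneGluingNoHeavyLowerTailSahiE3CovHit
import Literature.Probability.LatticeModels.SahiThirdOrderCorrelation
import Mathlib.Combinatorics.SetFamily.FourFunctions
import Mathlib.Tactic.Linarith
import Mathlib.Tactic.Ring
import HarnessLib
import HarnessLib.Audit

/-!
# `NoHeavyLowerTail` (crux stmt-CriticalPhenomena-4575), Sahi programme P4 (Holley / monotone coupling):
# FKG with cross meets and cross joins — `Z·m(S ∩ S') − m(S)·m(S') ≥ m(L ∖ (S ∪ S'))·m(S ∩ S') − m(Mt)·m(J)`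

Support file (cell `prim-l12`, seat P4, generation 7; `--supports stmt-CriticalPhenomena-4575`).  No named facts, no sorries; standard
axioms; def-free.

## The inequality

`L` finite distributive lattice, `μ ≥ 0` log-supermodular (not normalised, `Z = m(L)`), `S, S'` up-sets.  With the CROSS PAIRS
`(x, y) ∈ (S ∖ S') × (S' ∖ S)`, their meets `Mt = (S ∖ S') ⊼ (S' ∖ S) ⊆ L ∖ (S ∪ S')` and joins `J = (S ∖ S') ⊻ (S' ∖ S) ⊆ S ∩ S'`:

* `cov_upperSet_eq`: `Z·m(S ∩ S') − m(S)·m(S') = m(L ∖ (S ∪ S'))·m(S ∩ S') − m(S ∖ S')·m(S' ∖ S)` (bookkeeping);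
* `mass_sdiff_mul_le`: `m(S ∖ S')·m(S' ∖ S) ≤ m(Mt)·m(J)` — the four functions theorem [Ahlswede–Daykin] for `s = S ∖ S'`, `t = S' ∖ S`;
* `cov_upperSet_ge_cross`: `Z·m(S ∩ S') − m(S)·m(S') ≥ m(L ∖ (S ∪ S'))·m(S ∩ S') − m(Mt)·m(J) (≥ 0)`;
* corollaries: `cov_upperSet_ge_compl_mul_nonjoin` (`≥ m(L ∖ (S ∪ S'))·m((S ∩ S') ∖ J)`: the elements of `S ∩ S'` that are not a cross join
  contribute fully — contains `…SahiE3CovHit` / `…HitSlotAttribution.cov_upperSet_ge_mass_mul`, whose `H` never meets `J`), and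
  `cov_upperSet_ge_notMem_mul` (`≥ m((L ∖ (S ∪ S')) ∖ Mt)·m(S ∩ S')`, e.g. `≥ μ(⊥)·m(S ∩ S')` when no cross pair is disjoint).

Role ("slot-slack" method of the gen-7 memo, HOME prim-l12-p4/FROM-prim-l12-p4-gen7-HITSLOT-CERTIFICATE.md §5–6): these are the indicator
instances of the bound `Cov ≥ m(Q₀₀)m(W) − f₃(Q₀₀)f₄(W)` for slot-dominating `(f₃, f₄)`, to which the certificate inequality (R3) of the
k-join-prime programme reduces.
-/

namespace Summit.CriticalPhenomena.PercolationContinuityZ3.Theorems.SahiE3CovCross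

open Finset Literature.Probability.LatticeModels
open scoped BigOperators FinsetFamily

variable {α : Type*} [DistribLattice α] [Fintype α] [DecidableEq α]

omit [DistribLattice α] in
/-- Bookkeeping: `Z·m(S ∩ S') − m(S)·m(S') = m(L ∖ (S ∪ S'))·m(S ∩ S') − m(S ∖ S')·m(S' ∖ S)`. [folklore] -/
theorem cov_upperSet_eq (μ : α → ℝ) (S S' : Finset α) :
    mass μ univ * mass μ (S ∩ S') - mass μ S * mass μ S' =
      mass μ (univ \ (S ∪ S')) * mass μ (S ∩ S') - mass μ (S \ S') * mass μ (S' \ S) := by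
  have eS : mass μ S = mass μ (S \ S') + mass μ (S ∩ S') := by
    rw [← SahiE3CovHit.mass_union_of_disjoint μ (Finset.disjoint_sdiff_inter S S'), Finset.sdiff_union_inter]
  have eS' : mass μ S' = mass μ (S' \ S) + mass μ (S ∩ S') := by
    rw [Finset.inter_comm, ← SahiE3CovHit.mass_union_of_disjoint μ (Finset.disjoint_sdiff_inter S' S),
      Finset.sdiff_union_inter]
  have eZ : mass μ univ = mass μ (univ \ (S ∪ S')) + mass μ (S ∪ S') := by
    rw [← SahiE3CovHit.mass_union_of_disjoint μ Finset.sdiff_disjoint, Finset.sdiff_union_of_subset (subset_univ _)]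
  have eU : mass μ (S ∪ S') + mass μ (S ∩ S') = mass μ S + mass μ S' := by
    unfold mass; exact Finset.sum_union_inter
  have hU : mass μ (S ∪ S') = mass μ (S \ S') + mass μ (S' \ S) + mass μ (S ∩ S') := by linarith
  rw [eZ, eS, eS', hU]
  ring

omit [Fintype α] in
/-- **Four functions for the cross pairs**: `m(S ∖ S')·m(S' ∖ S) ≤ m((S ∖ S') ⊼ (S' ∖ S))·m((S ∖ S') ⊻ (S' ∖ S))`. [folklore] -/
theorem mass_sdiff_mul_le {μ : α → ℝ} (hμ₀ : 0 ≤ μ) (hμ : ∀ a b, μ a * μ b ≤ μ (a ⊓ b) * μ (a ⊔ b))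
    (S S' : Finset α) :
    mass μ (S \ S') * mass μ (S' \ S) ≤ mass μ ((S \ S') ⊼ (S' \ S)) * mass μ ((S \ S') ⊻ (S' \ S)) :=
  four_functions_theorem μ μ μ μ hμ₀ hμ₀ hμ₀ hμ₀ hμ (S \ S') (S' \ S)

/-- Cross meets lie outside `S ∪ S'` (for up-sets). [this work] -/
theorem infs_sdiff_subset {S S' : Finset α} (hS : IsUpperSet (S : Set α)) (hS' : IsUpperSet (S' : Set α)) :
    (S \ S') ⊼ (S' \ S) ⊆ univ \ (S ∪ S') := by
  intro z hz
  rw [Finset.mem_infs] at hz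
  obtain ⟨x, hx, y, hy, rfl⟩ := hz
  rw [Finset.mem_sdiff] at hx hy
  rw [Finset.mem_sdiff, Finset.mem_union]
  refine ⟨Finset.mem_univ _, ?_⟩
  rintro (h | h)
  · exact hy.2 (hS (show x ⊓ y ≤ y from inf_le_right) h)
  · exact hx.2 (hS' (show x ⊓ y ≤ x from inf_le_left) h)

omit [Fintype α] in
/-- Cross joins lie in `S ∩ S'` (for up-sets). [this work] -/
theorem sups_sdiff_subset {S S' : Finset α} (hS : IsUpperSet (S : Set α)) (hS' : IsUpperSet (S' : Set α)) :
    (S \ S') ⊻ (S' \ S) ⊆ S ∩ S' := by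
  intro w hw
  rw [Finset.mem_sups] at hw
  obtain ⟨x, hx, y, hy, rfl⟩ := hw
  rw [Finset.mem_sdiff] at hx hy
  rw [Finset.mem_inter]
  exact ⟨hS (show x ≤ x ⊔ y from le_sup_left) hx.1, hS' (show y ≤ x ⊔ y from le_sup_right) hy.1⟩

/-- **FKG with cross meets and joins**: for up-sets `S, S'`,
`Z·m(S ∩ S') − m(S)·m(S') ≥ m(L ∖ (S ∪ S'))·m(S ∩ S') − m(Mt)·m(J)` with `Mt, J` the cross meets and joins; the right side is `≥ 0`.
[this work] -/
theorem cov_upperSet_ge_cross {μ : α → ℝ} (hμ₀ : 0 ≤ μ) (hμ : ∀ a b, μ a * μ b ≤ μ (a ⊓ b) * μ (a ⊔ b))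
    (S S' : Finset α) :
    mass μ (univ \ (S ∪ S')) * mass μ (S ∩ S') - mass μ ((S \ S') ⊼ (S' \ S)) * mass μ ((S \ S') ⊻ (S' \ S)) ≤
      mass μ univ * mass μ (S ∩ S') - mass μ S * mass μ S' := by
  rw [cov_upperSet_eq]
  linarith [mass_sdiff_mul_le hμ₀ hμ S S']

/-- **The non-cross-join part of `S ∩ S'` contributes fully**: `Z·m(S ∩ S') − m(S)·m(S') ≥ m(L ∖ (S ∪ S'))·m((S ∩ S') ∖ J)`.
[this work] -/
theorem cov_upperSet_ge_compl_mul_nonjoin {μ : α → ℝ} (hμ₀ : 0 ≤ μ) (hμ : ∀ a b, μ a * μ b ≤ μ (a ⊓ b) * μ (a ⊔ b))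
    {S S' : Finset α} (hS : IsUpperSet (S : Set α)) (hS' : IsUpperSet (S' : Set α)) :
    mass μ (univ \ (S ∪ S')) * mass μ ((S ∩ S') \ ((S \ S') ⊻ (S' \ S))) ≤
      mass μ univ * mass μ (S ∩ S') - mass μ S * mass μ S' := by
  have h := cov_upperSet_ge_cross hμ₀ hμ S S'
  have hMt : mass μ ((S \ S') ⊼ (S' \ S)) ≤ mass μ (univ \ (S ∪ S')) := mass_mono hμ₀ (infs_sdiff_subset hS hS')
  have hJ0 : 0 ≤ mass μ ((S \ S') ⊻ (S' \ S)) := mass_nonneg hμ₀ _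
  have hsplit : mass μ (S ∩ S') = mass μ ((S ∩ S') \ ((S \ S') ⊻ (S' \ S))) + mass μ ((S \ S') ⊻ (S' \ S)) := by
    rw [← SahiE3CovHit.mass_union_of_disjoint μ Finset.sdiff_disjoint,
      Finset.sdiff_union_of_subset (sups_sdiff_subset hS hS')]
  have e : mass μ (univ \ (S ∪ S')) * mass μ (S ∩ S') =
      mass μ (univ \ (S ∪ S')) * mass μ ((S ∩ S') \ ((S \ S') ⊻ (S' \ S))) +
        mass μ (univ \ (S ∪ S')) * mass μ ((S \ S') ⊻ (S' \ S)) := by rw [hsplit]; ring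
  linarith [mul_le_mul_of_nonneg_right hMt hJ0]

/-- **The outside elements that are not a cross meet contribute fully**: `Z·m(S ∩ S') − m(S)·m(S') ≥ m((L ∖ (S ∪ S')) ∖ Mt)·m(S ∩ S')`;
e.g. `≥ μ(⊥)·m(S ∩ S')` when no cross pair has meet `⊥`. [this work] -/
theorem cov_upperSet_ge_notMem_mul {μ : α → ℝ} (hμ₀ : 0 ≤ μ) (hμ : ∀ a b, μ a * μ b ≤ μ (a ⊓ b) * μ (a ⊔ b))
    {S S' : Finset α} (hS : IsUpperSet (S : Set α)) (hS' : IsUpperSet (S' : Set α)) :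
    mass μ ((univ \ (S ∪ S')) \ ((S \ S') ⊼ (S' \ S))) * mass μ (S ∩ S') ≤
      mass μ univ * mass μ (S ∩ S') - mass μ S * mass μ S' := by
  have h := cov_upperSet_ge_cross hμ₀ hμ S S'
  have hJ : mass μ ((S \ S') ⊻ (S' \ S)) ≤ mass μ (S ∩ S') := mass_mono hμ₀ (sups_sdiff_subset hS hS')
  have hM0 : 0 ≤ mass μ ((S \ S') ⊼ (S' \ S)) := mass_nonneg hμ₀ _
  have hsplit : mass μ (univ \ (S ∪ S')) =
      mass μ ((univ \ (S ∪ S')) \ ((S \ S') ⊼ (S' \ S))) + mass μ ((S \ S') ⊼ (S' \ S)) := by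
    rw [← SahiE3CovHit.mass_union_of_disjoint μ Finset.sdiff_disjoint,
      Finset.sdiff_union_of_subset (infs_sdiff_subset hS hS')]
  have e : mass μ (univ \ (S ∪ S')) * mass μ (S ∩ S') =
      mass μ ((univ \ (S ∪ S')) \ ((S \ S') ⊼ (S' \ S))) * mass μ (S ∩ S') +
        mass μ ((S \ S') ⊼ (S' \ S)) * mass μ (S ∩ S') := by rw [hsplit]; ring
  linarith [mul_le_mul_of_nonneg_left hJ hM0]

end Summit.CriticalPhenomena.PercolationContinuityZ3.Theorems.SahiE3CovCross
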